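import Mathlib
import Summits.Ventures.PercRepro2.A3InactiveTyped

/-!
# Row 2′TB (typed BHK 1.4 single-vertex): THE FLIP-FAMILY LEMMA (blind cell PercRepro2, p5 g4,
2026-08-25; proofs/P5-RULES.md §1)

All-free profile (`hF : ∀ e, e ∈ F`): the first copy `y` is the RED colouring, the second copy
`flipOn F y` the BLUE one. For a SOURCE `y` (`a₁ ↮ a₂` in both copies, `b ∈ C₁(y)`,
`o ∈ C₂(y)`, `o ∉ C₂(flipOn F y)`) let `T := C_red(a₂)`, `T′ := C_blue(a₂)`, `E_r := T ∖ T′`.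
For a finite vertex set `Z ⊆ E_r` with
* (Z1) `o ∈ Z` and a red route from `o` to a vertex `c ∈ T′` through edges touching `Z`
  inside `Z ∪ {c}`;
* (Z2) every vertex of `E_r` blue-adjacent to `Z` lies in `Z`;
* (Z3) every vertex of `C_blue(a₁)` red-adjacent to `Z` lies in `Z`,
the STAR FLIP `starFlip ends Z y` (every edge touching `Z` changes colour) is a TARGET:
`a₁ ↮ a₂` in both copies, `b ∈ C₁`, `o ∈ C₂` of the blue copy and `o ∉ C₂` of the red copy.
The maps `ψ` (`Z = E_r`) and the mirror of the component flip (`Z` = the component of `o` in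
`H[E_r]`) are the extreme members of the family; the `(Z2)/(Z3)`-closure of the shortest red
`o → T′` routes is its minimum. Every step is a closed-set argument (`mem_of_conn_of_closed`) or a
monotonicity (`conn_mono`); no certificate, standard axioms.
-/

namespace Summit.Ventures.PercRepro2

namespace TB14FlipFamily

open A3InactiveTyped

section Flip

variable {V : Type} {E : Type} [DecidableEq E]
variable (ends : E → Sym2 V) (a₁ a₂ b o : V) (F : Finset E)

/-- The edge `e` touches the vertex set `Z`: one of its ends lies in `Z`. -/
def Touch (Z : Finset V) (e : E) : Prop := ∃ x ∈ Z, x ∈ ends e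

open Classical in
/-- **The star flip**: every edge touching `Z` changes colour, every other edge keeps it. -/
noncomputable def starFlip (Z : Finset V) (y : Config E) : Config E :=
  fun e => if Touch ends Z e then !(y e) else y e

open Classical in
/-- The red configuration with the edges touching `Z` closed. -/
noncomputable def offZ (Z : Finset V) (y : Config E) : Config E :=
  fun e => if Touch ends Z e then false else y e

open Classical in
/-- The route configuration: the red edges touching `Z` inside `Z ∪ {c}`. -/
noncomputable def routeCfg (Z : Finset V) (c : V) (y : Config E) : Config E :=
  fun e => if Touch ends Z e ∧ (∀ x ∈ ends e, x ∈ Z ∨ x = c) then y e else false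

/-- A SOURCE of row 2′TB. -/
structure IsSrc (y : Config E) : Prop where
  q₁ : ¬ Conn ends y a₁ a₂
  q₂ : ¬ Conn ends (flipOn F y) a₁ a₂
  hb : Conn ends y a₁ b
  ho : Conn ends y a₂ o
  ho' : ¬ Conn ends (flipOn F y) a₂ o

/-- A TARGET of row 2′TB. -/
structure IsTgt (y : Config E) : Prop where
  q₁ : ¬ Conn ends y a₁ a₂
  q₂ : ¬ Conn ends (flipOn F y) a₁ a₂
  hb : Conn ends y a₁ b
  ho : Conn ends (flipOn F y) a₂ o
  ho' : ¬ Conn ends y a₂ o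

/-- **The admissible flip sets** of a source `y` (conditions (Z1)–(Z3) of P5-RULES.md §1). -/
structure Admissible (Z : Finset V) (y : Config E) : Prop where
  /-- `Z ⊆ E_r = C_red(a₂) ∖ C_blue(a₂)`. -/
  sub : ∀ v ∈ Z, Conn ends y a₂ v ∧ ¬ Conn ends (flipOn F y) a₂ v
  /-- `o ∈ Z`. -/
  ho : o ∈ Z
  /-- (Z1) a red route from `o` to a vertex `c` of `C_blue(a₂)` through `Z`. -/
  route : ∃ c, Conn ends (flipOn F y) a₂ c ∧ Conn ends (routeCfg ends Z c y) o c
  /-- (Z2) `Z` is closed under blue adjacency inside `E_r`. -/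
  z2 : ∀ v ∈ Z, ∀ u, (∃ e, flipOn F y e = true ∧ ends e = s(v, u)) →
    Conn ends y a₂ u → ¬ Conn ends (flipOn F y) a₂ u → u ∈ Z
  /-- (Z3) every vertex of `C_blue(a₁)` red-adjacent to `Z` lies in `Z`. -/
  z3 : ∀ v ∈ Z, ∀ u, (∃ e, y e = true ∧ ends e = s(v, u)) → Conn ends (flipOn F y) a₁ u → u ∈ Z

omit [DecidableEq E] in
/-- An edge with an end `x ∈ Z` touches `Z`. -/
lemma touch_of_ends {Z : Finset V} {e : E} {x u : V} (h : ends e = s(x, u)) (hx : x ∈ Z) :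
    Touch ends Z e := ⟨x, hx, by rw [h]; exact Sym2.mem_mk_left x u⟩

omit [DecidableEq E] in
/-- An edge with an end `u ∈ Z` touches `Z`. -/
lemma touch_of_ends' {Z : Finset V} {e : E} {x u : V} (h : ends e = s(x, u)) (hu : u ∈ Z) :
    Touch ends Z e := ⟨u, hu, by rw [h]; exact Sym2.mem_mk_right x u⟩

omit [DecidableEq E] in
/-- An edge touching `Z` with ends `{x, u}` has `x ∈ Z` or `u ∈ Z`. -/
lemma mem_or_mem_of_touch {Z : Finset V} {e : E} {x u : V} (h : ends e = s(x, u))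
    (ht : Touch ends Z e) : x ∈ Z ∨ u ∈ Z := by
  obtain ⟨w, hw, hwe⟩ := ht
  rw [h, Sym2.mem_iff] at hwe
  rcases hwe with rfl | rfl
  · exact Or.inl hw
  · exact Or.inr hw

omit [DecidableEq E] in
/-- The star flip changes the colour of an edge touching `Z`. -/
lemma starFlip_of_touch {Z : Finset V} {y : Config E} {e : E} (h : Touch ends Z e) :
    starFlip ends Z y e = !(y e) := by
  unfold starFlip; rw [if_pos h]

omit [DecidableEq E] in
/-- The star flip keeps the colour of an edge not touching `Z`. -/
lemma starFlip_of_not_touch {Z : Finset V} {y : Config E} {e : E} (h : ¬ Touch ends Z e) :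
    starFlip ends Z y e = y e := by
  unfold starFlip; rw [if_neg h]

/-- The blue copy of the flipped configuration: old red at `Z`, old blue elsewhere. -/
lemma flipOn_starFlip_of_touch (hF : ∀ e, e ∈ F) {Z : Finset V} {y : Config E} {e : E}
    (h : Touch ends Z e) : flipOn F (starFlip ends Z y) e = y e := by
  unfold flipOn; rw [if_pos (hF e), starFlip_of_touch ends h, Bool.not_not]
/-- The blue copy of the flipped configuration off `Z` is the old blue copy. -/

lemma flipOn_starFlip_of_not_touch (hF : ∀ e, e ∈ F) {Z : Finset V} {y : Config E} {e : E}
    (h : ¬ Touch ends Z e) : flipOn F (starFlip ends Z y) e = flipOn F y e := by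
  unfold flipOn; rw [if_pos (hF e), if_pos (hF e), starFlip_of_not_touch ends h]

omit [DecidableEq E] in
/-- Closing the edges at `Z` only closes edges. -/
lemma offZ_le {Z : Finset V} (y : Config E) : offZ ends Z y ≤ y := by
  intro e
  unfold offZ
  split_ifs
  · exact Bool.false_le _
  · exact le_rfl

omit [DecidableEq E] in
/-- In a configuration whose edges at `Z` are closed, nothing outside `Z` reaches `Z`. -/
lemma not_mem_of_conn_offZ {Z : Finset V} {y : Config E} {v u : V} (hv : v ∉ Z)
    (h : Conn ends (offZ ends Z y) v u) : u ∉ Z := by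
  have key : u ∈ {x : V | x ∉ Z} := by
    refine mem_of_conn_of_closed (ends := ends) (ω := offZ ends Z y) ?_ hv h
    intro x hx z hxz
    obtain ⟨_, e, he, hends⟩ := openGraph_adj.1 hxz
    intro hz
    have ht : Touch ends Z e := touch_of_ends' ends hends hz
    unfold offZ at he
    rw [if_pos ht] at he
    exact Bool.false_ne_true he
  exact key

end Flip

section Main

variable {V : Type} {E : Type} [DecidableEq E]
variable (ends : E → Sym2 V) (a₁ a₂ b o : V) (F : Finset E)
/-- `a₂ ∉ Z` (`Z` avoids `C_blue(a₂)`). -/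

lemma a2_not_mem {Z : Finset V} {y : Config E} (hZ : Admissible ends a₁ a₂ o F Z y) : a₂ ∉ Z :=
  fun h => (hZ.sub a₂ h).2 (conn_refl ends _ a₂)
/-- `a₁ ∉ Z` (`Z ⊆ C_red(a₂)` and `a₁ ↮ a₂`). -/

lemma a1_not_mem {Z : Finset V} {y : Config E} (hs : IsSrc ends a₁ a₂ b o F y)
    (hZ : Admissible ends a₁ a₂ o F Z y) : a₁ ∉ Z :=
  fun h => hs.q₁ (conn_symm (hZ.sub a₁ h).1)

/-- No vertex of `C_blue(a₂)` lies in `Z`. -/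
lemma not_mem_of_conn_blue {Z : Finset V} {y : Config E} (hZ : Admissible ends a₁ a₂ o F Z y)
    {u : V} (hu : Conn ends (flipOn F y) a₂ u) : u ∉ Z :=
  fun h => (hZ.sub u h).2 hu

/-- No vertex of `C_red(a₁)` lies in `Z` (the red clusters of the roots are disjoint). -/
lemma not_mem_of_conn_red_a1 {Z : Finset V} {y : Config E} (hs : IsSrc ends a₁ a₂ b o F y)
    (hZ : Admissible ends a₁ a₂ o F Z y) {u : V} (hu : Conn ends y a₁ u) : u ∉ Z :=
  fun h => hs.q₁ (conn_trans hu (conn_symm (hZ.sub u h).1))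

/-- **(A)** The red cluster of `a₂` after the flip is contained in its red cluster with the edges at
`Z` closed. -/
lemma conn_offZ_of_conn_starFlip (hF : ∀ e, e ∈ F) {Z : Finset V} {y : Config E}
    (hZ : Admissible ends a₁ a₂ o F Z y) {u : V} (hu : Conn ends (starFlip ends Z y) a₂ u) :
    Conn ends (offZ ends Z y) a₂ u := by
  have ha₂ : a₂ ∉ Z := a2_not_mem ends a₁ a₂ o F hZ
  refine mem_of_conn_of_closed (ends := ends) (ω := starFlip ends Z y)
    (S := {x : V | Conn ends (offZ ends Z y) a₂ x}) ?_ (conn_refl ends _ a₂) hu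
  intro x hx z hxz
  obtain ⟨_, e, he, hends⟩ := openGraph_adj.1 hxz
  simp only [Set.mem_setOf_eq] at hx ⊢
  by_cases ht : Touch ends Z e
  · exfalso
    -- `x ∉ Z` (reached in `offZ`), so `z ∈ Z`; the edge is old blue between `x ∈ T` and `z ∈ Z`
    have hxZ : x ∉ Z := not_mem_of_conn_offZ ends ha₂ hx
    have hzZ : z ∈ Z := (mem_or_mem_of_touch ends hends ht).resolve_left hxZ
    rw [starFlip_of_touch ends ht] at he
    have hye : y e = false := by
      cases h : y e
      · rfl
      · rw [h] at he; exact absurd he (by decide)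
    have hblue : flipOn F y e = true := by unfold flipOn; rw [if_pos (hF e), hye]; rfl
    have hxT : Conn ends y a₂ x := conn_mono (offZ_le ends y) hx
    by_cases hxT' : Conn ends (flipOn F y) a₂ x
    · -- `x ∈ C_blue(a₂)` would put `z ∈ Z` into `C_blue(a₂)`
      exact (hZ.sub z hzZ).2 (conn_trans hxT' (conn_of_openAdj ⟨e, hblue, hends⟩))
    · -- `x ∈ E_r ∖ Z` blue-adjacent to `Z`: (Z2)
      exact hxZ (hZ.z2 z hzZ x ⟨e, hblue, by rw [hends, Sym2.eq_swap]⟩ hxT hxT')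
  · rw [starFlip_of_not_touch ends ht] at he
    have : offZ ends Z y e = true := by unfold offZ; rw [if_neg ht]; exact he
    exact conn_trans hx (conn_of_openAdj ⟨e, this, hends⟩)

/-- **(B)** After the flip `a₁ ∉ C_blue(a₂)`: the blue cluster of `a₂` avoids the blue cluster of
`a₁` computed with the edges at `Z` closed. -/
lemma not_conn_blue_a1_of_conn_blue_starFlip (hF : ∀ e, e ∈ F) {Z : Finset V} {y : Config E}
    (hs : IsSrc ends a₁ a₂ b o F y) (hZ : Admissible ends a₁ a₂ o F Z y) {u : V}
    (hu : Conn ends (flipOn F (starFlip ends Z y)) a₂ u) :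
    ¬ Conn ends (offZ ends Z (flipOn F y)) a₁ u := by
  have ha₁ : a₁ ∉ Z := a1_not_mem ends a₁ a₂ b o F hs hZ
  have key : u ∈ {x : V | ¬ Conn ends (offZ ends Z (flipOn F y)) a₁ x} := by
    refine mem_of_conn_of_closed (ends := ends) (ω := flipOn F (starFlip ends Z y)) ?_ ?_ hu
    · intro x hx z hxz
      obtain ⟨_, e, he, hends⟩ := openGraph_adj.1 hxz
      simp only [Set.mem_setOf_eq] at hx ⊢
      intro hz
      by_cases ht : Touch ends Z e
      · -- `z ∉ Z` (reached in `offZ`), so `x ∈ Z`; the edge is old red between `x ∈ Z` and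
        -- `z ∈ C_blue(a₁)`: (Z3) puts `z` into `Z`
        have hzZ : z ∉ Z := not_mem_of_conn_offZ ends ha₁ hz
        have hxZ : x ∈ Z := (mem_or_mem_of_touch ends hends ht).resolve_right hzZ
        rw [flipOn_starFlip_of_touch ends F hF ht] at he
        have hz' : Conn ends (flipOn F y) a₁ z := conn_mono (offZ_le ends _) hz
        exact hzZ (hZ.z3 x hxZ z ⟨e, he, hends⟩ hz')
      · rw [flipOn_starFlip_of_not_touch ends F hF ht] at he
        have : offZ ends Z (flipOn F y) e = true := by unfold offZ; rw [if_neg ht]; exact he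
        exact hx (conn_trans hz (conn_of_openAdj ⟨e, this, by rw [hends, Sym2.eq_swap]⟩))
    · simp only [Set.mem_setOf_eq]
      intro h
      exact hs.q₂ (conn_mono (offZ_le ends _) h)
  exact key

/-- **(C)** The red cluster of `a₁` survives the flip (no edge of it touches `Z`). -/
lemma conn_starFlip_a1_of_conn {Z : Finset V} {y : Config E}
    (hs : IsSrc ends a₁ a₂ b o F y) (hZ : Admissible ends a₁ a₂ o F Z y) {u : V}
    (hu : Conn ends y a₁ u) : Conn ends (starFlip ends Z y) a₁ u := by
  have key : u ∈ {x : V | Conn ends y a₁ x ∧ Conn ends (starFlip ends Z y) a₁ x} := by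
    refine mem_of_conn_of_closed (ends := ends) (ω := y) ?_ ⟨conn_refl _ _ _, conn_refl _ _ _⟩ hu
    rintro x ⟨hx₁, hx₂⟩ z hxz
    obtain ⟨_, e, he, hends⟩ := openGraph_adj.1 hxz
    have hz₁ : Conn ends y a₁ z := conn_trans hx₁ (conn_of_openAdj ⟨e, he, hends⟩)
    refine ⟨hz₁, ?_⟩
    have ht : ¬ Touch ends Z e := by
      intro ht
      rcases mem_or_mem_of_touch ends hends ht with hxZ | hzZ
      · exact not_mem_of_conn_red_a1 ends a₁ a₂ b o F hs hZ hx₁ hxZ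
      · exact not_mem_of_conn_red_a1 ends a₁ a₂ b o F hs hZ hz₁ hzZ
    have : starFlip ends Z y e = true := by rw [starFlip_of_not_touch ends ht]; exact he
    exact conn_trans hx₂ (conn_of_openAdj ⟨e, this, hends⟩)
  exact key.2

/-- **(D₁)** The blue cluster of `a₂` survives the flip (no edge of it touches `Z`). -/
lemma conn_blue_starFlip_a2_of_conn (hF : ∀ e, e ∈ F) {Z : Finset V} {y : Config E}
    (hZ : Admissible ends a₁ a₂ o F Z y) {u : V} (hu : Conn ends (flipOn F y) a₂ u) :
    Conn ends (flipOn F (starFlip ends Z y)) a₂ u := by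
  have key : u ∈ {x : V | Conn ends (flipOn F y) a₂ x ∧
      Conn ends (flipOn F (starFlip ends Z y)) a₂ x} := by
    refine mem_of_conn_of_closed (ends := ends) (ω := flipOn F y) ?_
      ⟨conn_refl _ _ _, conn_refl _ _ _⟩ hu
    rintro x ⟨hx₁, hx₂⟩ z hxz
    obtain ⟨_, e, he, hends⟩ := openGraph_adj.1 hxz
    have hz₁ : Conn ends (flipOn F y) a₂ z := conn_trans hx₁ (conn_of_openAdj ⟨e, he, hends⟩)
    refine ⟨hz₁, ?_⟩
    have ht : ¬ Touch ends Z e := by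
      intro ht
      rcases mem_or_mem_of_touch ends hends ht with hxZ | hzZ
      · exact not_mem_of_conn_blue ends a₁ a₂ o F hZ hx₁ hxZ
      · exact not_mem_of_conn_blue ends a₁ a₂ o F hZ hz₁ hzZ
    have : flipOn F (starFlip ends Z y) e = true := by
      rw [flipOn_starFlip_of_not_touch ends F hF ht]; exact he
    exact conn_trans hx₂ (conn_of_openAdj ⟨e, this, hends⟩)
  exact key.2

/-- **(D₂)** The red route through `Z` is blue after the flip. -/
lemma routeCfg_le_flipOn_starFlip (hF : ∀ e, e ∈ F) (Z : Finset V) (c : V) (y : Config E) :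
    routeCfg ends Z c y ≤ flipOn F (starFlip ends Z y) := by
  intro e
  unfold routeCfg
  split_ifs with h
  · rw [flipOn_starFlip_of_touch ends F hF h.1]
  · exact Bool.false_le _

/-- **THE FLIP-FAMILY LEMMA**: the star flip of an admissible `Z` sends a source to a target. -/
theorem isTgt_starFlip (hF : ∀ e, e ∈ F) {Z : Finset V} {y : Config E}
    (hs : IsSrc ends a₁ a₂ b o F y) (hZ : Admissible ends a₁ a₂ o F Z y) :
    IsTgt ends a₁ a₂ b o F (starFlip ends Z y) := by
  have ha₂ : a₂ ∉ Z := a2_not_mem ends a₁ a₂ o F hZ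
  refine ⟨?_, ?_, ?_, ?_, ?_⟩
  · -- red: `a₁ ↮ a₂`
    intro h
    have h' := conn_offZ_of_conn_starFlip ends a₁ a₂ o F hF hZ (conn_symm h)
    exact hs.q₁ (conn_symm (conn_mono (offZ_le ends y) h'))
  · -- blue: `a₁ ↮ a₂`
    intro h
    exact not_conn_blue_a1_of_conn_blue_starFlip ends a₁ a₂ b o F hF hs hZ (conn_symm h)
      (conn_refl ends _ a₁)
  · exact conn_starFlip_a1_of_conn ends a₁ a₂ b o F hs hZ hs.hb
  · -- blue: `a₂ ↔ c ↔ o`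
    obtain ⟨c, hc, hroute⟩ := hZ.route
    have h₁ : Conn ends (flipOn F (starFlip ends Z y)) a₂ c :=
      conn_blue_starFlip_a2_of_conn ends a₁ a₂ o F hF hZ hc
    have h₂ : Conn ends (flipOn F (starFlip ends Z y)) o c :=
      conn_mono (routeCfg_le_flipOn_starFlip ends F hF Z c y) hroute
    exact conn_trans h₁ (conn_symm h₂)
  · -- red: `o ∉ C(a₂)` since `o ∈ Z` and `Z` is isolated off its edges
    intro h
    have h' := conn_offZ_of_conn_starFlip ends a₁ a₂ o F hF hZ h
    exact not_mem_of_conn_offZ ends ha₂ h' hZ.ho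

end Main

end TB14FlipFamily

end Summit.Ventures.PercRepro2
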